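import Summits.CriticalPhenomena.SAWScalingLimit.Theses.SAWDefectDecoherence
import Summits.CriticalPhenomena.SAWScalingLimit.Theorems.SAWDefectDecoherenceMassRatioRenewalCut
import Summits.CriticalPhenomena.SAWScalingLimit.Theorems.SAWDefectDecoherenceMassRatioRenewalDictionaryB
import Summits.CriticalPhenomena.SAWScalingLimit.Theorems.SAWDefectDecoherenceMassRatioRenewalSurgeryB
import Summits.CriticalPhenomena.SAWScalingLimit.Theorems.SAWDefectDecoherenceMassRatioRenewalBlockModule
import Summits.CriticalPhenomena.SAWScalingLimit.Theorems.MassRatio.Negative.RowsB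
import Summits.CriticalPhenomena.SAWScalingLimit.Theorems.MassRatio.Negative.Component
import Literature.Probability.RandomPlanarGeometry.HexSAWBridgeDecay

/-!
# Crux `SAWDefectDecoherence.MassRatio` (stmt-CriticalPhenomena-8550) — line `renewal-averaging-at-b`

Skeleton (crux-plan, round 2) for the crux idea card
`Cruxes/MassRatio/Ideas/renewal-averaging-at-b.md` (ideator 4; triage r2: 3 × pass, each with the
SAME mandatory sharpening S1 "shave LOCALLY, not the global half-space `Λ^{>h}`", carried out here).

**The crux.** In the frame of `MassRatio` (Dobrushin domain flat near `b = D.pt 1` on `B(b,ρ)`,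
admissible `Λ_δ` with the ROWS CLAUSE `v ∈ Λ_δ ↔ m_δ ≤ row v` inside `B(b,ρ)`, exhaustion of compacts,
`δ·a_δ → a`, `δ·b_δ → b`): `δ² Σ_{e ∈ K} Z_δ(a_δ → e) ≤ C δ^{-3/4} Z_δ(a_δ → b_δ)` eventually
(`Z = |F_{x_c,0}|`, predicted ratio `δ^{-25/48}`, slack `11/48`).

**Idea (the lever).** Read the walks `a_δ → b_δ` backwards from the boundary POINT `b_δ`. Inside
`B(b,ρ)` the rows clause makes `Λ_δ` the exact half-lattice `{row ≥ m}` and `b_δ` a DOOR edge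
`door m p = {(m-1,p),(m,p)}` (brick coordinates `row/pos/bv` of `Negative.Brick`; `frame_door`,
proved). Put the window box `box m p h W` = rows `[m, m+h)` × positions `[p-W, p+W]` on the door
(`W = A t`, `t ≤ h ≤ 2t`, `t = tOf ≍ ρ₀/(Aδ)`: a MACROSCOPIC box of height `≍ ρ₀/A` and width
`≍ ρ₀`, inside `B(b,ρ)` and away from the root — `ρ₀ = min ρ ‖a-b‖`, since the frame allows the
root ON the flat piece inside `B(b,ρ)`). Cutting a walk `a_δ → b_δ` at its entrance into the box
through the top edge `top m p h j`, at the FIRST level `h ∈ [t,2t]` that is a renewal level of the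
final box-confined piece (Kesten: all later vertices below, all earlier above), is injective and
weight-multiplicative, whence the RENEWAL CUT (stub 1, provable combinatorics)
`Σ_{h∈[t,2t]} Σ_{|j|≤W} Z_{Λ∖box_h}(a_δ → top_{h,j}) · κ_t(h,j) ≤ Z_Λ(a_δ → b_δ)`,
with the `δ`-FREE, translation-invariant RENEWAL KERNEL `κ_t(h,j) = kernel m p t W h j` = `x_c`-mass
of box-confined walks `top_{h,j} → door` with no renewal level in `[t,h)`. Under Kesten's
`x_c`-renewal measure on the half-lattice (irreducible bridges are a probability law because
`Σ_T B_T = ∞`, Madras–Slade (4.2.4)) the total kernel mass `boxMass` is the probability that the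
first renewal level `≥ t` is `≤ 2t` with a laterally confined prefix; Paley–Zygmund bounds it below
by `Σ_{[t,2t]} B_s / (1 + 2Σ_{≤t} B_s)` (`B_s = HV.stripBlim s = P(s is a renewal level)`), which is
`≥ p₁ > 0` exactly when `T ↦ B_T` is DYADICALLY REGULAR (stub 2 `RenewalBlock`, a shape statement on
ONE explicit sequence; stub 3 the Kesten/Paley–Zygmund identification; stub 4 the lateral
confinement). So the POINT mass at `b_δ` dominates `p₁/2 ×` a `κ̂`-AVERAGE of point masses over the
macroscopic flat tops of the shaved domains `Λ_δ ∖ box_h`, at NO cost in the exponent (the quarter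
law `12/48` of every fixed-level cut is first-moment renewal counting; block counting moves the price
into the exponent-free regularity statement `RenewalBlock`). What is left is stub 5, the crux with
its boundary POINT replaced by that kernel average (ArcMassRatio, kernel-weighted local form = triage
r2-2 S3), carrying the full `11/48` slack: `δ²Σ_K Z · boxMass ≤ C δ^{-3/4} · cutSum`.

**STATE (lead a1, after wave 1, 2026-08-16).** The b-side MODULE is LANDED as Theorems files:
`stub_renewalCut` (p88044), `stub_bridgeDictionary` (p87433/p90368), `stub_renewalSurgery`
(p88224/p90367), `stub_blockModule` (p88188) over the vocabulary `SAWDefectDecoherenceMassRatioRenewalDefs`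
(p85286) — Kesten's renewal structure at `x_c` in finitary form (no measure theory, no `I(x_c) = 1`:
the renewal EQUATION `B_s = Σ_{k<s} B_k I_{s-k}` comes out of the two surgery inequalities in the
limit `W → ∞`, and block counting is the exact identity `Σ_{s=t}^{2t} B_s = Σ_h a_h Σ_{r ≤ 2t-h} B_r`,
sharper than Paley–Zygmund). Three registered stubs remain, all OPEN PROBLEMS stated plainly:
* `stub_renewalBlock` — dyadic block regularity of `T ↦ B_T = HV.stripBlim T`; wave 1 typed its exact
  content: `⟺ BridgeAveraged B` (`Σ_{s≤t} B_s ≤ C t B_t`, a one-sided Karamata bound) modulo the strip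
  identity — the first bridge lower bound better than `c/T` on dyadic blocks; not in print.
* `stub_lateralConfinement` — wave 1 typed its exact content: `⟺ LateralTightness` (uniform-in-`t`
  lateral tightness of renewal-free critical half-plane prefixes); every tool in print/tree is a HEIGHT
  or exit-mass statement. KEPT deliberately: dropping it (letting the glue take the module's `W(t)` by
  monotonicity and a slower height scale) would make stub 5 range over LOW plateaus whose kernel average
  concentrates on a vanishing window — the point problem re-imported (memo `work/stub5/ANALYSIS.md` §4.2).
* `stub_arcMassRatio` — the kernel-weighted arc mass ratio at the cut `3/4` over MACROSCOPIC boxes of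
  aspect `A`; conjecture-grade, crux-equivalent modulo exponent-`0` comparabilities (memo §2.3, §4.1).

**Proved here (no `sorry`; axioms `propext`, `Classical.choice`, `Quot.sound`).** `frame_door`
(eventually `b_δ = door (m δ) p`, `(p - m δ) % 2 = 0`, outer endpoint off `Λ_δ`), `frame_box` (eventually
`Rect (m δ) (m δ + 2t) (p - At) (p + At) ⊆ Λ_δ`), `eventually_le_tOf` (`t(δ) → ∞`, uses `ρ > 0` and
`D.pt 0 ≠ D.pt 1`), lattice metric helpers, the composition `massRatio_of_hyps : RenewalBlock-statement →
LateralConfinement-statement → ArcMassRatio-statement → MassRatio` (hypotheses inlined verbatim, so that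
it can be LANDED as a Theorems file), and `MassRatio_of : MassRatio := massRatio_of_hyps stub_renewalBlock
stub_lateralConfinement stub_arcMassRatio` (the crux BY NAME).

**Disproof used** (`Cruxes/MassRatio/Disproof.lean` cycle 4 + companions; landed
`Theorems/MassRatio/Negative/*`, imported here: `Brick`, `Walks`, `Tools`, `RowsA/B`, `Component`).
`massRatio_false_without_rows`: the rows clause is consumed by `frame_door`/`frame_box` (glue) — it is
what makes `b_δ` a door and the box the exact half-lattice, i.e. what makes `κ` `δ`-free — and by
stub 5 (full frame); in the fjord families `LamF`/`Λ₂` of the Negative series the reversed walk from the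
starved edge has NO renewal inside the corridor and the cut degenerates, as it must.
`massRatio_false_without_bLimit`: `δ·b_δ → b` locates the box (`frame_door`, `frame_box`).
`massRatio_false_without_rho_pos`: `tOf` needs `ρ₀ = min ρ ‖a-b‖ > 0` (`eventually_le_tOf`).
`massRatio_false_without_exhaustion`: exhaustion is used on the bulk side only, inside stub 5, which
carries the whole frame (so the `Λ₃` family of `DisproofExhaustion §K` is not an instance of any stub).
`corridor_transfer`/`verts_eq_corridor`: a bare corridor at the ROOT is a common factor of both sides of
stub 5 and of stub 1 (degree-one homogeneity in the walks from `a_δ`), consistent.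
`massRatio_frame_nonvacuous` (`D₀`, both marks on the bottom side): the triage's witness against the
card's GLOBAL shaving `Λ^{>h}`; with the LOCAL box the root `aE` stays in `Λ ∖ box_h` and every stub is
non-vacuous there. No stub is an instance of a landed Negative lemma (those refute clause-deleted
variants of the crux; stubs 1–4 are frame-free lattice statements, stub 5 keeps every clause).
`nonempty_saw_of_preconnected` / `massRatio_iff_withoutPreconnected`: decoration, kept verbatim in `Frame`.

**Triage answers.** r2-1/r2-2/r2-3 S1 (load-bearing): done — `box`/`Λ ∖ box_h`, never `Λ^{>h}`; the
root-on-the-flat-piece frames are handled by the scale `ρ₀ = min ρ ‖pt 0 - pt 1‖`. r2-2 S2: stub 2 is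
documented as an averaged `TailLower(κ)` + regularity, not "exponent-free for free". r2-2 S3 / r2-1
sharpen 2: `LateralSpread` dropped, stub 5 is the `κ`-weighted form the glue consumes (r2-3's caveat —
a sum-rule engine for stub 5 may want the kernel's spread back — recorded in the line card).
r2-3 sharpen 3: `I(x_c) = 1` is inside stub 3 and follows from `RenewalBlock` itself
(`Σ_{[t,2t]} B_s ≥ p₀ B_1 > 0` on every dyadic block ⟹ `Σ B_T = ∞`), so neither `E_T ≡ 0` nor
`stripBlim_ge`'s summability branch is needed.
-/

noncomputable section

namespace Summit.CriticalPhenomena.SAWScalingLimit.Cruxes.MassRatio.RenewalAveragingAtB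

open Literature.Probability.LatticeModels Literature.Probability.RandomPlanarGeometry
open Literature.Probability.RandomPlanarGeometry.SAW
open Summit.CriticalPhenomena.SAWScalingLimit.Theses.SAWDefectDecoherence
open Summit.CriticalPhenomena.SAWScalingLimit.Theorems.MassRatio.Negative
open Summit.CriticalPhenomena.SAWScalingLimit.Theorems.MassRatio.Renewal

/-! ## Objects: all landed (`Theorems/SAWDefectDecoherenceMassRatioRenewalDefs.lean`, p85286) -/

/-! ## Stubs

Registered on the crux item; `sorry` only here. LANDED (reshape 1, wave 1 — imported above, no longer
stubs of this file): `stub_renewalCut` (p88044, `…RenewalCut.lean`), `stub_bridgeDictionary` (p87433 +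
p90368, `…RenewalDictionaryA/B.lean`), `stub_renewalSurgery` (p88224 + p90367, `…RenewalSurgeryA/B.lean`),
`stub_blockModule` (p88188, `…RenewalBlockModule.lean`). -/

/-- **Stub 2 — dyadic block regularity of `T ↦ B_T` (RenewalBlock; OPEN — shape, not exponent).**
`∃ p₀ > 0, t₀, ∀ t ≥ t₀: p₀ · Σ_{s=1}^{t} B_s ≤ Σ_{s=t}^{2t} B_s`, `B_s = HV.stripBlim s = sup_L B_{s,L}(x_c)`
(DCS strip bridges; `= P(s is a renewal level)` under Kesten's measure). Why plausibly true: any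
`B_T ≍ T^{-α}` with `α < 1` (prediction `α = 2h_b - 1 = 1/4`; BGJ arXiv:1110.1141 p.4: the
exact `T ≤ 10` data give a smooth local exponent `→ -0.25`, `B_1/B_0 = 0.90`, `B_2/B_1 = 0.93`) gives it
with `p₀ → (2^{1-α}-1)`. Why it might fail / what it costs (triage r2-2 S2): it FORCES
`Σ_{s ≤ t} B_s ≥ c t^{log₂(1+p₀)}`, an averaged `TailLower(κ > 0)` — the first bridge lower bound below
the random-walk value `B_T ≍ 1/T` (at which `p(t) ≍ 1/log t` and the line yields nothing) — plus dyadic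
regularity; rigorous today: `c/T ≤ B_T` (DCS §3 Remark 2, given strip subcriticality) and `B_T → 0`
(`HV.tendsto_stripBlim`, PROVED; KP23 arXiv:2310.17299 Thm 2 quantifies `≤ T^{-ε₀}`). Natural suppliers:
`Cruxes/MassRatio/PinchedDoubleBridgeGainModule.lean` (`tailLower_of_gain : StripIdentity →
IntersectionGain → TailLower`), DCS's recursion `B_T - B_{T+1} ≤ c_α x_c^{-1} B_{T+1}²`
(`HV.stripA_succ_le`) which alone gives only `B_{2T} ≥ B_T/(1 + C T B_T)`. Size: open (soft). -/
theorem stub_renewalBlock :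
    ∃ p₀ : ℝ, 0 < p₀ ∧ ∃ t₀ : ℕ, ∀ t : ℕ, t₀ ≤ t →
      p₀ * ∑ s ∈ Finset.Icc 1 t, HV.stripBlim s ≤ ∑ s ∈ Finset.Icc t (2 * t), HV.stripBlim s := by
  sorry

/-- **Stub 4 — lateral confinement of the renewal prefix (LateralConfinement; OPEN-soft).**
`∀ ε > 0 ∃ A ≥ 1, t₂, ∀ t ≥ t₂ ∀ W ∀ doors: boxMass(t, W) ≤ boxMass(t, A t) + ε` — the kernel mass
carried by prefixes (height `≤ 2t`, up to their first renewal level `≥ t`) that leave the lateral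
window `|pos - p| ≤ A t` is `≤ ε`, UNIFORMLY in the scale `t` (for `W ≤ A t` it is monotonicity).
Under Kesten's measure: `P(the walk reaches lateral distance A t before height 2t) → 0` as `A → ∞`
uniformly in `t` — tightness of the width/height ratio of critical half-plane SAW, predicted by
isotropic scaling (`ν = 3/4` in both directions; the prefix width is dominated by its largest
irreducible blocks, `≍ t`). Why it might fail / status (triage r2-2 S3, r2-1): plausible from strip
subcriticality with a `T`-UNIFORM rate (a quantitative `μ_{2t} < μ` on the lateral scale `t`:
`x_c`-walks confined to `2t` rows pay `e^{-c·width/t}`), which is not in print or in the tree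
(`HV.tendsto_stripBlim`, `escape_ge` are height statements); KP23's averaged renewal times are the
nearest tool. A is the box ASPECT ratio: the glue makes the box flatter, not smaller (width `≍ ρ₀`,
height `≍ ρ₀/A`, both macroscopic). Size: open (soft; polynomial/constant strength, no exponent). -/
theorem stub_lateralConfinement :
    ∀ ε : ℝ, 0 < ε → ∃ A : ℕ, 1 ≤ A ∧ ∃ t₂ : ℕ, ∀ t : ℕ, t₂ ≤ t →
      ∀ (W : ℕ) (m p : ℤ), (p - m) % 2 = 0 → boxMass m p t W ≤ boxMass m p t (A * t) + ε := by
  sorry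

/-- **Stub 5 — kernel-weighted arc mass ratio at the cut `3/4` (ArcMassRatio; HARDEST; open,
conjecture-grade).** In the crux frame, for every aspect `A ≥ 1` and compact `K ⊆ Ω` there is `C` with,
eventually, for the door position `p` of `b_δ` and `t = tOf D ρ A δ ≍ ρ₀/(32 A δ)`:
`δ² Σ_{e ∈ K} Z_Λ(a_δ → e) · boxMass ≤ C δ^{-3/4} · Σ_{h∈[t,2t]} Σ_{|j| ≤ At} Z_{Λ∖box_h}(a_δ → top_{h,j}) κ_t(h,j)`,
i.e. (dividing by `boxMass > 0`) the crux with `Z(a_δ → b_δ)` replaced by the `κ̂ = κ/Σκ`-AVERAGE of the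
point masses at the top mid-edges of the macroscopic flat notches `Λ_δ ∖ box_h` (width `≍ ρ₀`, height
`hδ ∈ [ρ₀/(32A), ρ₀/(16A)]`, inside `B(b, ρ/2)`, at distance `≥ ‖a-b‖/2` from the root). Predicted TRUE
with the crux's full slack: bulk side `≍ δ^{2}·δ^{-2}·δ^{h_b + x₁} = δ^{35/48}`, arc side
`δ^{-36/48} · δ^{2h_b} = δ^{24/48}` for EVERY probability kernel on the notch tops (each `top_{h,j}` is a
flat boundary point at macroscopic distance from `a`; the re-entrant notch corners only enhance
arrivals), margin `11/48`. Why it is not a costume: it is implied by nothing weaker than the crux plus a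
reverse fair-share bound, and it implies the crux only through stubs 1–4; the point `b_δ`, every
lattice-scale issue at `b` and the `12/48` quarter law are gone, and its right side is a boundary
ARC functional `Σ_u κ̂(u) Z(a → u)` over `≍ 1/δ` points — the only kind of boundary quantity sum rules
(`DuminilCopinSmirnov2012_lemma2`-type identities, the dial/flux identities of card conjugate-spin-gap)
see exactly. Why it might fail as a LEMMA (not as a fact): it still contains both sharp certifications
of the necessity ledger (`Ideator6Necessity.md` §1: bulk `p ≥ 0.50`, boundary `q ≤ 1.48`; MassRatio(3/4)
is false for simple random walk, so RW-level tools cannot prove it), and a sum-rule engine may need the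
kernel's lateral spread (`κ̂(h,·) ≳ 1/t` on a window — the dropped `LateralSpread`, triage r2-3 sharpen 2)
to pass from the `κ̂`-average to a flux. Frame clauses: all kept (rows, `ρ > 0`, `b_δ → b`, exhaustion —
the last is load-bearing here and only here, `massRatio_false_without_exhaustion`). Size: open-problem. -/
theorem stub_arcMassRatio :
    ∀ A : ℕ, 1 ≤ A →
      ∀ (D : DobrushinDomain) (ρ : ℝ) (Λ : ℝ → Finset HexVertex) (m : ℝ → ℤ)
        (a b : ℝ → Sym2 HexVertex),
        0 < ρ →
        D.carrier ∩ Metric.ball (D.pt 1) ρ = {z : ℂ | (D.pt 1).im < z.im} ∩ Metric.ball (D.pt 1) ρ →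
        (∀ᶠ δ : ℝ in nhdsWithin 0 (Set.Ioi 0),
          hexDomainSimplyConnected (Λ δ) ∧ a δ ∈ hexDomainBoundary (Λ δ) ∧
            b δ ∈ hexDomainBoundary (Λ δ) ∧ Nonempty (HexMidEdgeSAW (Λ δ) (a δ) (b δ)) ∧
            (hexGraph.induce ((Λ δ : Finset HexVertex) : Set HexVertex)).Preconnected ∧
            (∀ v ∈ Λ δ, (δ : ℂ) * hexCenter v ∈ D.carrier) ∧
            (∀ v : HexVertex, (δ : ℂ) * hexCenter v ∈ Metric.ball (D.pt 1) ρ →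
              (v ∈ Λ δ ↔ m δ ≤ v.1 1))) →
        (∀ K : Set ℂ, IsCompact K → K ⊆ D.carrier → ∀ᶠ δ : ℝ in nhdsWithin 0 (Set.Ioi 0),
          ∀ v : HexVertex, (δ : ℂ) * hexCenter v ∈ K → v ∈ Λ δ) →
        Filter.Tendsto (fun δ : ℝ => (δ : ℂ) * hexMidpoint (a δ)) (nhdsWithin 0 (Set.Ioi 0))
          (nhds (D.pt 0)) →
        Filter.Tendsto (fun δ : ℝ => (δ : ℂ) * hexMidpoint (b δ)) (nhdsWithin 0 (Set.Ioi 0))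
          (nhds (D.pt 1)) →
        ∀ K : Set ℂ, IsCompact K → K ⊆ D.carrier → ∃ C : ℝ,
          ∀ᶠ δ : ℝ in nhdsWithin 0 (Set.Ioi 0), ∀ p : ℤ, b δ = door (m δ) p →
            δ ^ 2 * (∑ᶠ e ∈ {e : Sym2 HexVertex | e ∈ hexDomainMidEdges (Λ δ) ∧
                (δ : ℂ) * hexMidpoint e ∈ K}, Z (Λ δ) (a δ) e) *
                boxMass (m δ) p (tOf D ρ A δ) (A * tOf D ρ A δ) ≤
              C * δ ^ (-(3 : ℝ) / 4) * cutSum (Λ δ) (a δ) (m δ) p (tOf D ρ A δ) (A * tOf D ρ A δ) := by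
  sorry

/-! ## Glue (proved) -/

/-- `Z ≥ 0`. -/
theorem Z_nonneg (Λ : Finset HexVertex) (a z : Sym2 HexVertex) : 0 ≤ Z Λ a z := norm_nonneg _

/-- `cutSum ≥ 0`. -/
theorem cutSum_nonneg (Λ : Finset HexVertex) (a : Sym2 HexVertex) (m p : ℤ) (t W : ℕ) :
    0 ≤ cutSum Λ a m p t W :=
  Finset.sum_nonneg fun _ _ => Finset.sum_nonneg fun _ _ =>
    mul_nonneg (Z_nonneg _ _ _) (kernel_nonneg _ _ _ _ _ _)

/-- Adjacent honeycomb vertices have centres at distance `≤ 2` (crude; the truth is `1/√3`). -/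
theorem norm_hexCenter_sub_le_two {u v : HexVertex} (h : hexGraph.Adj u v) :
    ‖hexCenter u - hexCenter v‖ ≤ 2 := by
  have hre : (hexCenter u - hexCenter v).re = ((pos u : ℝ) - pos v) / 2 := by
    rw [Complex.sub_re, hexCenter_re, hexCenter_re]; ring
  have hs : Real.sqrt 3 / 2 ≤ 1 := by
    rw [div_le_one (by norm_num : (0:ℝ) < 2)]
    exact (Real.sqrt_lt' (by norm_num : (0:ℝ) < 2) |>.2 (by norm_num : (3:ℝ) < 2 ^ 2)).le
  have hs0 : 0 ≤ Real.sqrt 3 / 2 := by positivity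
  have hrow : (row u : ℝ) - row v ≤ 1 ∧ (row v : ℝ) - row u ≤ 1 := by
    rcases (adj_iff u v).1 h with ⟨h1, -⟩ | ⟨-, h1, -⟩ | ⟨-, h1, -⟩
    · rw [h1]; norm_num
    · constructor <;> (push_cast [h1]; linarith)
    · constructor <;> (push_cast [h1]; linarith)
  have hposd : (pos u : ℝ) - pos v ≤ 1 ∧ (pos v : ℝ) - pos u ≤ 1 := by
    rcases (adj_iff u v).1 h with ⟨-, h1 | h1⟩ | ⟨h1, -⟩ | ⟨h1, -⟩
    · constructor <;> (push_cast [h1]; linarith)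
    · constructor <;> (push_cast [h1]; linarith)
    · rw [h1]; norm_num
    · rw [h1]; norm_num
  have hk : ∀ w : HexVertex, (0 : ℝ) ≤ ((w.2 : ℕ) : ℝ) ∧ (((w.2 : ℕ) : ℝ)) ≤ 1 := by
    intro w
    refine ⟨by positivity, ?_⟩
    have : (w.2 : ℕ) ≤ 1 := by have := w.2.isLt; omega
    exact_mod_cast this
  have him : |(hexCenter u - hexCenter v).im| ≤ 3 / 2 := by
    rw [Complex.sub_im, hexCenter_im, hexCenter_im, abs_le]
    obtain ⟨hu0, hu1⟩ := hk u
    obtain ⟨hv0, hv1⟩ := hk v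
    constructor <;> nlinarith
  have hre' : |(hexCenter u - hexCenter v).re| ≤ 1 / 2 := by
    rw [hre, abs_le]; constructor <;> linarith [hposd.1, hposd.2]
  calc ‖hexCenter u - hexCenter v‖
      ≤ |(hexCenter u - hexCenter v).re| + |(hexCenter u - hexCenter v).im| :=
        Complex.norm_le_abs_re_add_abs_im _
    _ ≤ 1 / 2 + 3 / 2 := add_le_add hre' him
    _ = 2 := by norm_num

/-- An endpoint of an edge is within distance `1` of its midpoint. -/
theorem norm_hexCenter_sub_hexMidpoint_le {u v : HexVertex} (h : hexGraph.Adj u v) :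
    ‖hexCenter u - hexMidpoint s(u, v)‖ ≤ 1 := by
  rw [hexMidpoint_mk]
  have : hexCenter u - (hexCenter u + hexCenter v) / 2 = (hexCenter u - hexCenter v) / 2 := by ring
  rw [this, norm_div, Complex.norm_ofNat]
  linarith [norm_hexCenter_sub_le_two h]

/-- **Frame ⇒ door.** Eventually the marked boundary mid-edge `b_δ` is a door edge of the exact
half-lattice: `b_δ = door (m δ) p` with `(p - m δ) % 2 = 0` and outer endpoint off `Λ_δ`. -/
theorem frame_door {D : DobrushinDomain} {ρ : ℝ} {Λ : ℝ → Finset HexVertex} {m : ℝ → ℤ}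
    {a b : ℝ → Sym2 HexVertex} (hρ : 0 < ρ)
    (hev : ∀ᶠ δ : ℝ in nhdsWithin 0 (Set.Ioi 0),
      hexDomainSimplyConnected (Λ δ) ∧ a δ ∈ hexDomainBoundary (Λ δ) ∧
      b δ ∈ hexDomainBoundary (Λ δ) ∧ Nonempty (HexMidEdgeSAW (Λ δ) (a δ) (b δ)) ∧
      (hexGraph.induce ((Λ δ : Finset HexVertex) : Set HexVertex)).Preconnected ∧
      (∀ v ∈ Λ δ, (δ : ℂ) * hexCenter v ∈ D.carrier) ∧
      (∀ v : HexVertex, (δ : ℂ) * hexCenter v ∈ Metric.ball (D.pt 1) ρ →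
        (v ∈ Λ δ ↔ m δ ≤ v.1 1)))
    (hb : Filter.Tendsto (fun δ : ℝ => (δ : ℂ) * hexMidpoint (b δ)) (nhdsWithin 0 (Set.Ioi 0))
      (nhds (D.pt 1))) :
    ∀ᶠ δ : ℝ in nhdsWithin 0 (Set.Ioi 0),
      ∃ p : ℤ, b δ = door (m δ) p ∧ (p - m δ) % 2 = 0 ∧ bv (m δ - 1) p ∉ Λ δ := by
  have hb' : ∀ᶠ δ : ℝ in nhdsWithin 0 (Set.Ioi 0),
      dist ((δ : ℂ) * hexMidpoint (b δ)) (D.pt 1) < ρ / 2 :=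
    Metric.tendsto_nhds.1 hb (ρ / 2) (by positivity)
  have hsmall : ∀ᶠ δ : ℝ in nhdsWithin 0 (Set.Ioi 0), δ < ρ / 2 :=
    mem_nhdsWithin_of_mem_nhds (Iio_mem_nhds (by positivity))
  have hpos : ∀ᶠ δ : ℝ in nhdsWithin 0 (Set.Ioi 0), 0 < δ := eventually_mem_nhdsWithin
  filter_upwards [hev, hb', hsmall, hpos] with δ hevδ hbδ hδρ hδ
  obtain ⟨-, -, hbd, -, -, -, hrows⟩ := hevδ
  obtain ⟨hedge, u, v, hbuv, hv, hu⟩ := hbd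
  have hadj : hexGraph.Adj u v := by
    rw [hbuv] at hedge; exact hedge
  -- both endpoints of `b_δ` have their scaled centres in the ball `B(pt 1, ρ)`
  have hball : ∀ w : HexVertex, w = u ∨ w = v →
      (δ : ℂ) * hexCenter w ∈ Metric.ball (D.pt 1) ρ := by
    intro w hw
    have hw1 : ‖hexCenter w - hexMidpoint (b δ)‖ ≤ 1 := by
      rcases hw with rfl | rfl
      · rw [hbuv]; exact norm_hexCenter_sub_hexMidpoint_le hadj
      · rw [hbuv, Sym2.eq_swap]; exact norm_hexCenter_sub_hexMidpoint_le hadj.symm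
    rw [Metric.mem_ball]
    have hd1 : dist ((δ : ℂ) * hexCenter w) ((δ : ℂ) * hexMidpoint (b δ)) ≤ δ * 1 := by
      rw [dist_eq_norm, ← mul_sub, norm_mul, Complex.norm_real, Real.norm_of_nonneg hδ.le]
      exact mul_le_mul_of_nonneg_left hw1 hδ.le
    calc dist ((δ : ℂ) * hexCenter w) (D.pt 1)
        ≤ dist ((δ : ℂ) * hexCenter w) ((δ : ℂ) * hexMidpoint (b δ)) +
            dist ((δ : ℂ) * hexMidpoint (b δ)) (D.pt 1) := dist_triangle _ _ _
      _ < δ * 1 + ρ / 2 := add_lt_add_of_le_of_lt hd1 hbδ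
      _ < ρ := by linarith
  have hvrow : m δ ≤ row v := (hrows v (hball v (Or.inr rfl))).1 hv
  have hurow : row u < m δ := by
    by_contra hcon
    exact hu ((hrows u (hball u (Or.inl rfl))).2 (not_lt.1 hcon))
  rcases (adj_iff u v).1 hadj with ⟨h1, -⟩ | ⟨-, h1, -⟩ | ⟨h1, h2, h3⟩
  · exfalso; omega
  · exfalso; omega
  · have hru : row u = m δ - 1 := by omega
    have hrv : row v = m δ := by omega
    have hu' : bv (m δ - 1) (pos v) = u := by rw [← hru, ← h1, bv_row_pos]
    have hv' : bv (m δ) (pos v) = v := by rw [← hrv, bv_row_pos]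
    refine ⟨pos v, ?_, ?_, ?_⟩
    · rw [hbuv, door, hu', hv']
    · omega
    · rw [hu']; exact hu

/-- **Frame ⇒ box.** Eventually the lattice rectangle of `2t + 1` rows and half-width `A t`
above the door of `b_δ` lies in `Λ_δ` (it sits inside `B(b, ρ)`, where `Λ_δ` is the exact
half-lattice by the rows clause), `t = tOf D ρ A δ`. -/
theorem frame_box {D : DobrushinDomain} {ρ : ℝ} {Λ : ℝ → Finset HexVertex} {m : ℝ → ℤ}
    {a b : ℝ → Sym2 HexVertex} (hρ : 0 < ρ)
    (hev : ∀ᶠ δ : ℝ in nhdsWithin 0 (Set.Ioi 0),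
      hexDomainSimplyConnected (Λ δ) ∧ a δ ∈ hexDomainBoundary (Λ δ) ∧
      b δ ∈ hexDomainBoundary (Λ δ) ∧ Nonempty (HexMidEdgeSAW (Λ δ) (a δ) (b δ)) ∧
      (hexGraph.induce ((Λ δ : Finset HexVertex) : Set HexVertex)).Preconnected ∧
      (∀ v ∈ Λ δ, (δ : ℂ) * hexCenter v ∈ D.carrier) ∧
      (∀ v : HexVertex, (δ : ℂ) * hexCenter v ∈ Metric.ball (D.pt 1) ρ →
        (v ∈ Λ δ ↔ m δ ≤ v.1 1)))
    (hb : Filter.Tendsto (fun δ : ℝ => (δ : ℂ) * hexMidpoint (b δ)) (nhdsWithin 0 (Set.Ioi 0))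
      (nhds (D.pt 1))) {A : ℕ} (hA : 1 ≤ A) :
    ∀ᶠ δ : ℝ in nhdsWithin 0 (Set.Ioi 0), ∀ p : ℤ, b δ = door (m δ) p →
      Rect (m δ) (m δ + 2 * (tOf D ρ A δ)) (p - (A * tOf D ρ A δ : ℕ)) (p + (A * tOf D ρ A δ : ℕ))
        ⊆ Λ δ := by
  have hb' : ∀ᶠ δ : ℝ in nhdsWithin 0 (Set.Ioi 0),
      dist ((δ : ℂ) * hexMidpoint (b δ)) (D.pt 1) < ρ / 2 :=
    Metric.tendsto_nhds.1 hb (ρ / 2) (by positivity)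
  have hsmall : ∀ᶠ δ : ℝ in nhdsWithin 0 (Set.Ioi 0), δ < ρ / 16 :=
    mem_nhdsWithin_of_mem_nhds (Iio_mem_nhds (by positivity))
  have hpos : ∀ᶠ δ : ℝ in nhdsWithin 0 (Set.Ioi 0), 0 < δ := eventually_mem_nhdsWithin
  filter_upwards [hev, hb', hsmall, hpos] with δ hevδ hbδ hδρ hδ p hbp
  obtain ⟨-, -, -, -, -, -, hrows⟩ := hevδ
  have hρ0 : rho0 D ρ ≤ ρ := min_le_left _ _
  have hρ0' : 0 ≤ rho0 D ρ := le_min hρ.le dist_nonneg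
  have hA' : (1 : ℝ) ≤ A := by exact_mod_cast hA
  have hA0 : (0 : ℝ) ≤ A := by positivity
  have ht0 : (0 : ℝ) ≤ (tOf D ρ A δ : ℝ) := by positivity
  -- `δ A t ≤ ρ₀ / 32`
  have htδ : δ * (A : ℝ) * (tOf D ρ A δ : ℝ) ≤ rho0 D ρ / 32 := by
    have h1 : ((tOf D ρ A δ : ℕ) : ℝ) ≤ rho0 D ρ / (32 * (A : ℝ) * δ) := by
      unfold tOf; exact Nat.floor_le (by positivity)
    rw [le_div_iff₀ (by positivity)] at h1
    nlinarith
  intro v hv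
  rw [mem_Rect] at hv
  obtain ⟨hr1, hr2, hp1, hp2⟩ := hv
  apply (hrows v ?_).2 hr1
  -- the scaled centre of `v` is within `ρ` of `pt 1`
  rw [Metric.mem_ball]
  have hmid_re : ((δ : ℂ) * hexMidpoint (b δ)).re = δ * ((p : ℝ) + 1) / 2 := by
    rw [hbp, door, Complex.re_ofReal_mul, mid_re, pos_bv, pos_bv]; ring
  have hmid_im_lo : δ * hgt * ((m δ : ℝ) - 1 + 1 / 3) ≤ ((δ : ℂ) * hexMidpoint (b δ)).im := by
    rw [hbp, door, Complex.im_ofReal_mul, mid_im]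
    have h1 := hexCenter_im_ge (bv (m δ - 1) p)
    have h2 := hexCenter_im_ge (bv (m δ) p)
    rw [row_bv] at h1 h2
    rw [show Real.sqrt 3 / 2 = hgt from rfl] at h1 h2
    push_cast at h1 h2 ⊢
    nlinarith [hgt_pos]
  have hmid_im_hi : ((δ : ℂ) * hexMidpoint (b δ)).im ≤ δ * hgt * ((m δ : ℝ) + 2 / 3) := by
    rw [hbp, door, Complex.im_ofReal_mul, mid_im]
    have h1 := hexCenter_im_le (bv (m δ - 1) p)
    have h2 := hexCenter_im_le (bv (m δ) p)
    rw [row_bv] at h1 h2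
    rw [show Real.sqrt 3 / 2 = hgt from rfl] at h1 h2
    push_cast at h1 h2 ⊢
    nlinarith [hgt_pos]
  have hv_re : ((δ : ℂ) * hexCenter v).re = δ * ((pos v : ℝ) + 1) / 2 := re_scaled δ v
  have hv_im_lo := im_scaled_ge δ hδ.le v
  have hv_im_hi := im_scaled_le δ hδ.le v
  have hr1' : (m δ : ℝ) ≤ row v := by exact_mod_cast hr1
  have hr2' : (row v : ℝ) ≤ m δ + 2 * (tOf D ρ A δ : ℝ) := by exact_mod_cast hr2
  have hp1' : (p : ℝ) - (A : ℝ) * (tOf D ρ A δ : ℝ) ≤ pos v := by exact_mod_cast hp1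
  have hp2' : (pos v : ℝ) ≤ p + (A : ℝ) * (tOf D ρ A δ : ℝ) := by exact_mod_cast hp2
  have hh := hgt_lt
  have hh0 := hgt_pos
  have hδh : 0 ≤ δ * hgt := by positivity
  have hδt : 0 ≤ δ * (tOf D ρ A δ : ℝ) := by positivity
  have hdre : |((δ : ℂ) * hexCenter v - (δ : ℂ) * hexMidpoint (b δ)).re| ≤
      δ * (A : ℝ) * (tOf D ρ A δ : ℝ) / 2 := by
    rw [Complex.sub_re, hv_re, hmid_re, abs_le]
    constructor <;> nlinarith [mul_le_mul_of_nonneg_left hp1' hδ.le, mul_le_mul_of_nonneg_left hp2' hδ.le]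
  have hdim : |((δ : ℂ) * hexCenter v - (δ : ℂ) * hexMidpoint (b δ)).im| ≤
      δ * (2 * (tOf D ρ A δ : ℝ) + 2) := by
    rw [Complex.sub_im, abs_le]
    have k1 : δ * hgt * ((row v : ℝ) + 2 / 3) - δ * hgt * ((m δ : ℝ) - 1 + 1 / 3) ≤
        δ * (2 * (tOf D ρ A δ : ℝ) + 2) := by
      nlinarith [mul_le_mul_of_nonneg_left hr2' hδh, mul_le_mul_of_nonneg_left hh.le hδt,
        mul_le_mul_of_nonneg_left hh.le hδ.le]
    have k2 : -(δ * (2 * (tOf D ρ A δ : ℝ) + 2)) ≤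
        δ * hgt * ((row v : ℝ) + 1 / 3) - δ * hgt * ((m δ : ℝ) + 2 / 3) := by
      nlinarith [mul_le_mul_of_nonneg_left hr1' hδh, mul_le_mul_of_nonneg_left hh.le hδ.le]
    constructor <;> linarith
  have h2 : δ * (tOf D ρ A δ : ℝ) ≤ δ * (A : ℝ) * (tOf D ρ A δ : ℝ) := by
    nlinarith [mul_le_mul_of_nonneg_left hA' hδt]
  have hdist : dist ((δ : ℂ) * hexCenter v) ((δ : ℂ) * hexMidpoint (b δ)) ≤ ρ / 4 := by
    rw [dist_eq_norm]
    calc ‖(δ : ℂ) * hexCenter v - (δ : ℂ) * hexMidpoint (b δ)‖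
        ≤ |((δ : ℂ) * hexCenter v - (δ : ℂ) * hexMidpoint (b δ)).re| +
            |((δ : ℂ) * hexCenter v - (δ : ℂ) * hexMidpoint (b δ)).im| :=
          Complex.norm_le_abs_re_add_abs_im _
      _ ≤ δ * (A : ℝ) * (tOf D ρ A δ : ℝ) / 2 + δ * (2 * (tOf D ρ A δ : ℝ) + 2) :=
          add_le_add hdre hdim
      _ ≤ ρ / 4 := by nlinarith
  calc dist ((δ : ℂ) * hexCenter v) (D.pt 1)
      ≤ dist ((δ : ℂ) * hexCenter v) ((δ : ℂ) * hexMidpoint (b δ)) +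
          dist ((δ : ℂ) * hexMidpoint (b δ)) (D.pt 1) := dist_triangle _ _ _
    _ < ρ / 4 + ρ / 2 := add_lt_add_of_le_of_lt hdist hbδ
    _ < ρ := by linarith

/-- The lattice scale diverges: `t(δ) ≥ t₃` eventually. -/
theorem eventually_le_tOf (D : DobrushinDomain) {ρ : ℝ} (hρ : 0 < ρ) (A t₃ : ℕ) (hA : 1 ≤ A) :
    ∀ᶠ δ : ℝ in nhdsWithin 0 (Set.Ioi 0), t₃ ≤ tOf D ρ A δ := by
  have h01 : (0 : Fin 2) ≠ 1 := by decide
  have hρ0 : 0 < rho0 D ρ :=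
    lt_min hρ (dist_pos.2 fun h => h01 (D.pt_injective h))
  have hA' : (1 : ℝ) ≤ A := by exact_mod_cast hA
  have hcpos : 0 < rho0 D ρ / (32 * (A : ℝ) * ((t₃ : ℝ) + 1)) := by positivity
  have hsmall : ∀ᶠ δ : ℝ in nhdsWithin 0 (Set.Ioi 0),
      δ < rho0 D ρ / (32 * (A : ℝ) * ((t₃ : ℝ) + 1)) :=
    mem_nhdsWithin_of_mem_nhds (Iio_mem_nhds hcpos)
  have hpos : ∀ᶠ δ : ℝ in nhdsWithin 0 (Set.Ioi 0), 0 < δ := eventually_mem_nhdsWithin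
  filter_upwards [hsmall, hpos] with δ hδc hδ
  unfold tOf
  apply Nat.le_floor
  rw [le_div_iff₀ (by positivity)]
  rw [lt_div_iff₀ (by positivity)] at hδc
  nlinarith

/-! ## Composition: the line concludes the crux by name -/

/-- **The line concludes the crux from its three open statements** (hypotheses inlined verbatim =
the registered stubs 2, 4, 5, so that this composition can be LANDED as a Theorems file).
`RenewalBlock` feeds the LANDED b-side module (`stub_blockModule stub_bridgeDictionary stub_renewalSurgery`),
giving a floor `p₁ ≤ boxMass(t, W(t))` at every scale `t ≥ t₁` and every door; lateral confinement moves the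
floor to the aspect window `A·t` (`p₁/2 ≤ boxMass(t, A t)`); in the crux frame, eventually `b_δ` is a door
(`frame_door`), the box above it lies in `Λ_δ` (`frame_box`) and `t(δ) ≥ t₃` (`eventually_le_tOf`); the
LANDED renewal cut bounds the cut sum by `Z(a_δ → b_δ)`; the arc mass ratio bounds `δ²Σ_K Z · boxMass`
by `C δ^{-3/4} ·` the cut sum; divide by `boxMass ≥ p₁/2`. -/
theorem massRatio_of_hyps
    (hRB0 : ∃ p₀ : ℝ, 0 < p₀ ∧ ∃ t₀ : ℕ, ∀ t : ℕ, t₀ ≤ t →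
      p₀ * ∑ s ∈ Finset.Icc 1 t, HV.stripBlim s ≤ ∑ s ∈ Finset.Icc t (2 * t), HV.stripBlim s)
    (hLC0 : ∀ ε : ℝ, 0 < ε → ∃ A : ℕ, 1 ≤ A ∧ ∃ t₂ : ℕ, ∀ t : ℕ, t₂ ≤ t →
      ∀ (W : ℕ) (m p : ℤ), (p - m) % 2 = 0 → boxMass m p t W ≤ boxMass m p t (A * t) + ε)
    (hAMR0 : ∀ A : ℕ, 1 ≤ A →
      ∀ (D : DobrushinDomain) (ρ : ℝ) (Λ : ℝ → Finset HexVertex) (m : ℝ → ℤ)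
        (a b : ℝ → Sym2 HexVertex),
        0 < ρ →
        D.carrier ∩ Metric.ball (D.pt 1) ρ = {z : ℂ | (D.pt 1).im < z.im} ∩ Metric.ball (D.pt 1) ρ →
        (∀ᶠ δ : ℝ in nhdsWithin 0 (Set.Ioi 0),
          hexDomainSimplyConnected (Λ δ) ∧ a δ ∈ hexDomainBoundary (Λ δ) ∧
            b δ ∈ hexDomainBoundary (Λ δ) ∧ Nonempty (HexMidEdgeSAW (Λ δ) (a δ) (b δ)) ∧
            (hexGraph.induce ((Λ δ : Finset HexVertex) : Set HexVertex)).Preconnected ∧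
            (∀ v ∈ Λ δ, (δ : ℂ) * hexCenter v ∈ D.carrier) ∧
            (∀ v : HexVertex, (δ : ℂ) * hexCenter v ∈ Metric.ball (D.pt 1) ρ →
              (v ∈ Λ δ ↔ m δ ≤ v.1 1))) →
        (∀ K : Set ℂ, IsCompact K → K ⊆ D.carrier → ∀ᶠ δ : ℝ in nhdsWithin 0 (Set.Ioi 0),
          ∀ v : HexVertex, (δ : ℂ) * hexCenter v ∈ K → v ∈ Λ δ) →
        Filter.Tendsto (fun δ : ℝ => (δ : ℂ) * hexMidpoint (a δ)) (nhdsWithin 0 (Set.Ioi 0))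
          (nhds (D.pt 0)) →
        Filter.Tendsto (fun δ : ℝ => (δ : ℂ) * hexMidpoint (b δ)) (nhdsWithin 0 (Set.Ioi 0))
          (nhds (D.pt 1)) →
        ∀ K : Set ℂ, IsCompact K → K ⊆ D.carrier → ∃ C : ℝ,
          ∀ᶠ δ : ℝ in nhdsWithin 0 (Set.Ioi 0), ∀ p : ℤ, b δ = door (m δ) p →
            δ ^ 2 * (∑ᶠ e ∈ {e : Sym2 HexVertex | e ∈ hexDomainMidEdges (Λ δ) ∧
                (δ : ℂ) * hexMidpoint e ∈ K}, Z (Λ δ) (a δ) e) *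
                boxMass (m δ) p (tOf D ρ A δ) (A * tOf D ρ A δ) ≤
              C * δ ^ (-(3 : ℝ) / 4) * cutSum (Λ δ) (a δ) (m δ) p (tOf D ρ A δ) (A * tOf D ρ A δ)) :
    MassRatio := by
  -- b-side constants from stubs 2–4
  obtain ⟨p₀, hp₀, t₀, hRB⟩ := hRB0
  have hBM := stub_blockModule stub_bridgeDictionary stub_renewalSurgery p₀ t₀ hp₀ hRB
  unfold BoxMassFloor at hBM
  obtain ⟨p₁, hp₁, t₁, hK⟩ := hBM
  obtain ⟨A, hA, t₂, hLC⟩ := hLC0 (p₁ / 2) (by positivity)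
  have hmass : ∀ t : ℕ, max (max t₁ t₂) 1 ≤ t → ∀ m p : ℤ, (p - m) % 2 = 0 →
      p₁ / 2 ≤ boxMass m p t (A * t) := by
    intro t ht m p hpar
    obtain ⟨W, hW⟩ := hK t (le_trans (le_trans (le_max_left _ _) (le_max_left _ _)) ht)
    have h1 := hW m p hpar
    have h2 := hLC t (le_trans (le_trans (le_max_right _ _) (le_max_left _ _)) ht) W m p hpar
    linarith
  intro D ρ Λ m a b Zc hρ hflat hev hexh ha hb K hK hKD
  obtain ⟨C, hC⟩ := hAMR0 A hA D ρ Λ m a b hρ hflat hev hexh ha hb K hK hKD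
  refine ⟨max C 0 * (2 / p₁), ?_⟩
  have hpos : ∀ᶠ δ : ℝ in nhdsWithin 0 (Set.Ioi 0), 0 < δ := eventually_mem_nhdsWithin
  filter_upwards [hC, frame_door hρ hev hb, frame_box hρ hev hb hA,
    eventually_le_tOf D hρ A (max (max t₁ t₂) 1) hA, hpos] with δ hCδ hdoor hboxδ htδ hδ
  obtain ⟨p, hbp, hpar, hout⟩ := hdoor
  have ht1 : 1 ≤ tOf D ρ A δ := le_trans (le_max_right _ _) htδ
  -- stub 1 at the frame's box
  have hcut : cutSum (Λ δ) (a δ) (m δ) p (tOf D ρ A δ) (A * tOf D ρ A δ) ≤ Z (Λ δ) (a δ) (b δ) := by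
    rw [hbp]
    exact stub_renewalCut (Λ δ) (a δ) (m δ) p (tOf D ρ A δ) (A * tOf D ρ A δ) ht1 (hboxδ p hbp) hout
  have hm : p₁ / 2 ≤ boxMass (m δ) p (tOf D ρ A δ) (A * tOf D ρ A δ) := hmass _ htδ (m δ) p hpar
  have hCδ' := hCδ p hbp
  -- notation
  have hZc : ∀ e, ‖Zc δ e‖ = Z (Λ δ) (a δ) e := fun e => rfl
  simp only [hZc]
  set S : ℝ := δ ^ 2 * ∑ᶠ e ∈ {e : Sym2 HexVertex | e ∈ hexDomainMidEdges (Λ δ) ∧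
      (δ : ℂ) * hexMidpoint e ∈ K}, Z (Λ δ) (a δ) e with hS
  set M : ℝ := boxMass (m δ) p (tOf D ρ A δ) (A * tOf D ρ A δ) with hM
  have hMpos : 0 < M := lt_of_lt_of_le (by positivity) hm
  have hrpow : (0 : ℝ) ≤ δ ^ (-(3 : ℝ) / 4) := (Real.rpow_pos_of_pos hδ _).le
  have hZb : 0 ≤ Z (Λ δ) (a δ) (b δ) := Z_nonneg _ _ _
  have hcs := cutSum_nonneg (Λ δ) (a δ) (m δ) p (tOf D ρ A δ) (A * tOf D ρ A δ)
  have hX0 : 0 ≤ max C 0 * δ ^ (-(3 : ℝ) / 4) * Z (Λ δ) (a δ) (b δ) :=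
    mul_nonneg (mul_nonneg (le_max_right _ _) hrpow) hZb
  -- S * M ≤ max C 0 * δ^{-3/4} * Z(b_δ)
  have h1 : S * M ≤ max C 0 * δ ^ (-(3 : ℝ) / 4) * Z (Λ δ) (a δ) (b δ) :=
    calc S * M ≤ C * δ ^ (-(3 : ℝ) / 4) *
          cutSum (Λ δ) (a δ) (m δ) p (tOf D ρ A δ) (A * tOf D ρ A δ) := hCδ'
      _ ≤ max C 0 * δ ^ (-(3 : ℝ) / 4) *
          cutSum (Λ δ) (a δ) (m δ) p (tOf D ρ A δ) (A * tOf D ρ A δ) :=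
          mul_le_mul_of_nonneg_right (mul_le_mul_of_nonneg_right (le_max_left _ _) hrpow) hcs
      _ ≤ max C 0 * δ ^ (-(3 : ℝ) / 4) * Z (Λ δ) (a δ) (b δ) :=
          mul_le_mul_of_nonneg_left hcut (mul_nonneg (le_max_right _ _) hrpow)
  -- divide by M ≥ p₁ / 2
  have h2 : S ≤ max C 0 * δ ^ (-(3 : ℝ) / 4) * Z (Λ δ) (a δ) (b δ) / M := by
    rw [le_div_iff₀ hMpos]; exact h1
  have h3 : M⁻¹ ≤ 2 / p₁ := by
    rw [inv_le_comm₀ hMpos (by positivity), inv_div]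
    exact hm
  calc S ≤ max C 0 * δ ^ (-(3 : ℝ) / 4) * Z (Λ δ) (a δ) (b δ) / M := h2
    _ = max C 0 * δ ^ (-(3 : ℝ) / 4) * Z (Λ δ) (a δ) (b δ) * M⁻¹ := div_eq_mul_inv _ _
    _ ≤ max C 0 * δ ^ (-(3 : ℝ) / 4) * Z (Λ δ) (a δ) (b δ) * (2 / p₁) :=
        mul_le_mul_of_nonneg_left h3 hX0
    _ = max C 0 * (2 / p₁) * δ ^ (-(3 : ℝ) / 4) * Z (Λ δ) (a δ) (b δ) := by ring


/-- **The line concludes the crux** (by name, from the three registered stubs). -/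
theorem MassRatio_of : MassRatio :=
  massRatio_of_hyps stub_renewalBlock stub_lateralConfinement stub_arcMassRatio

end Summit.CriticalPhenomena.SAWScalingLimit.Cruxes.MassRatio.RenewalAveragingAtB
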